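import Summits.FinalStateConjecture.FinalStateConjecture.Theses.ClusterCompleteness
import Summits.FinalStateConjecture.FinalStateConjecture.Theorems.ClusterCompletenessAdiabaticMultiKerrILEDZoneKinematics
import Summits.FinalStateConjecture.FinalStateConjecture.Theorems.ClusterCompletenessAdiabaticMultiKerrILEDConstantAtInfinity
import Summits.FinalStateConjecture.FinalStateConjecture.Theorems.ClusterCompletenessAdiabaticMultiKerrILEDFlatMorawetzBulk
import Summits.FinalStateConjecture.FinalStateConjecture.Theorems.ClusterCompletenessAdiabaticMultiKerrILEDPerforatedHardy
import Summits.FinalStateConjecture.FinalStateConjecture.Theorems.ClusterCompletenessAdiabaticMultiKerrILEDFarTransport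
import Summits.FinalStateConjecture.FinalStateConjecture.Theorems.ClusterCompletenessAdiabaticMultiKerrILEDFiniteTimeEnergy
import Summits.FinalStateConjecture.FinalStateConjecture.Theorems.ClusterCompletenessAdiabaticMultiKerrILEDLateEnergyZero
import Summits.FinalStateConjecture.FinalStateConjecture.Theorems.ClusterCompletenessAdiabaticMultiKerrILEDZonePullbackWave
import Summits.FinalStateConjecture.FinalStateConjecture.Theorems.ClusterCompletenessAdiabaticMultiKerrILEDSliceLeafCorrespondence
import Summits.FinalStateConjecture.FinalStateConjecture.Theorems.ClusterCompletenessAdiabaticMultiKerrILEDBoundedOfIntegralIneq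
import Summits.FinalStateConjecture.FinalStateConjecture.Theorems.ClusterCompletenessAdiabaticMultiKerrILEDLateAssembly
import Summits.FinalStateConjecture.FinalStateConjecture.Theorems.ClusterCompletenessAdiabaticMultiKerrILEDRedShiftLocal
import Literature.Geometry.Lorentzian.KerrSchildMultiplierCurrent
import Literature.Geometry.Lorentzian.KerrSchildWaveCauchyProblem
import Literature.Geometry.Lorentzian.KerrHyperboloidalLeaves
import Literature.Geometry.Lorentzian.SlabTransportUniqueness
import Literature.Geometry.Lorentzian.KerrWaveDecay
import Literature.Geometry.Lorentzian.KerrDomainOfDependence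
import Literature.Geometry.Lorentzian.KerrSchildEnergyCurrent

/-!
# Crux `AdiabaticMultiKerrILED` — line `Sketch`: skeleton v9 (lead c4: the classical stubs W1–W4 and the
# assembly of (a) landed; sorries = the two research stubs)

Crux item `stmt-FinalStateConjecture-14310`, decl
`Summit.FinalStateConjecture.FinalStateConjecture.Theses.ClusterCompleteness.AdiabaticMultiKerrILED`
(uniform energy boundedness (a) + lab-ball ILED with loss of one derivative (b) for the
divergence-form wave equation on the tails-cut patched, strictly receding multi-Kerr background).

Composition (`adiabaticMultiKerrILED_of_statements` with the seven statements as hypotheses, and the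
hypothesis-free skeleton theorem `AdiabaticMultiKerrILED_of` applying it to the `stub_*`; kernel-checked):

* `stub_zoneKinematics` — Lorentz-contraction sandwich for the rest-frame spatial position of a lab
  point relative to a hole in inertial motion: `|d|² ≤ |z⃗|² ≤ γ² |d|²`, `d = y − p − t v` [M].
* `stub_constantAtInfinity` — a function with finite Dirichlet energy outside a ball of `ℝ³` has a
  constant at infinity in the Hardy sense (`∫ (φ − c)²/|y|² < ∞` far out) [M–L]. Normalises `ψ(0,·)`.
* `stub_energyBound` — (a): uniform boundedness of the lab-frame exterior energy [XL; the lead's].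
* `stub_nearZoneILED` — ILED with loss of one derivative in the moving zones `{rᵢ < 64Mᵢ}`, first AND
  zeroth order (the latter for the normalised `ψ − c`) [XL].
* `stub_flatMorawetzBulk` — existence of a smooth lab-centred KSS multiplier pair `(X = g(|y|²) y·∂, ϖ)`
  on Minkowski space with everywhere nonnegative modified bulk, coercive on `B_R` [M].
* `stub_perforatedHardy` — Hardy's inequality on `ℝ³` minus separated balls, universal constant [M–L]
  (the fixed-time zeroth-order boundary terms of the far multiplier).
* `stub_farTransport` — given the three previous inputs as hypotheses: Morawetz transport through the
  exactly flat inter-zone region — the lab-ball ILED is bounded by `sup_t E` plus the zone integrals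
  [L–XL].
Then (b) ≤ C_far (C_a E₀ + N C_nz (E₀ + E₁)) and (a) is `stub_energyBound`; the constants
`d₀, α, v₀` of the three quantitative stubs are reconciled by `max / min / min` (every hypothesis is
monotone in them), and the normalising constant `c` comes from `stub_constantAtInfinity` applied to
`y ↦ ψ(0, y)` outside a ball containing every hole at `t = 0` (when `E ψ 0 = ⊤` everything is trivial).
-/

noncomputable section

-- the doubled `FinalStateConjecture.FinalStateConjecture` path component trips dupNamespace
set_option linter.dupNamespace false

open scoped ContDiff Topology BigOperators ENNReal InnerProductSpace
open Filter Set MeasureTheory Literature.Geometry.Lorentzian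

namespace Summit.FinalStateConjecture.FinalStateConjecture.Cruxes.AdiabaticMultiKerrILED.Sketch

/-! ### Finite-time energy growth (classical; LANDED)

`stub_finiteTimeEnergy` — `E[ψ](t) ≤ K e^{Kt} E[ψ](0)` for `t ≥ 0` — is imported from its landed module
`Theorems/ClusterCompletenessAdiabaticMultiKerrILEDFiniteTimeEnergy.lean` (p123351; inputs `stub_cruxFieldPointwise`
p122113, `stub_slabWeight` p122515, `stub_slabGronwall` p122332, `stub_zoneDisjoint` p120074, `stub_pointwiseTerm`
p120308, `stub_termDerivBound` p120853, `stub_horizonFactor` p121588). -/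

/-! ### The research stubs (N ≥ 1) and the classical empty configuration (N = 0) -/

/-! `stub_lateEnergyBound_zero` — the empty configuration `N = 0`: `E[ψ](t) ≤ 18 E[ψ](0)` for `t ≥ 0` — is imported
from its landed module `Theorems/ClusterCompletenessAdiabaticMultiKerrILEDLateEnergyZero.lean` (p124812). -/

/-! ### v9 (lead c4): the late-time bound (a) reduced to the far-energy bound

`lateEnergyBound_pos` (N ≥ 1) is DERIVED (`:= stub_lateAssembly stub_redShiftLocal stub_zonePullbackWave
stub_sliceLeafCorrespondence stub_boundedOfIntegralIneq stub_farEnergyBound_pos`) along Dafermos–Rodnianski's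
red-shift boundedness argument run on the LAB foliation. All five classical inputs are LANDED and imported:
`stub_redShiftLocal` (Theorems/…RedShiftLocal.lean, p128544: the proved Literature red-shift estimate
`Kerr.redShift_estimate` with the wave equation assumed only on the collar in the future of the initial leaf),
`stub_zonePullbackWave` (…ZonePullbackWave.lean, p127754), `stub_sliceLeafCorrespondence`
(…SliceLeafCorrespondence.lean, p127675), `stub_boundedOfIntegralIneq` (…BoundedOfIntegralIneq.lean, p127568) and
the assembly `stub_lateAssembly` (…LateAssembly.lean, p128492, with helpers …LateTransport/LateCollar/LateRedShiftLab/
LateIneq/LateSplit). The ONLY remaining input of (a) is the research stub `stub_farEnergyBound_pos`. -/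

/-- **Energy boundedness away from the horizons, `N ≥ 1`** (RESEARCH stub of the reshaped line): for every
collar parameter `η > 0` there are `t₁` and `C` with
`∫_{{x⁰ = t} ∩ {∀ i, rᵢ ≥ r₊ᵢ + η Mᵢ}} ∑_μ (∂_μψ)² ≤ C E[ψ](0)` for all `t ≥ t₁`. `N = 1, a = 0`:
conservation and positivity of the `uᵢ`-energy (Killing, timelike off the horizon) plus the finite-time
bound; `N = 1`, `0 < |a| ≤ αM`: the superradiant part (Dafermos–Rodnianski arXiv:1010.5132, §1.4;
DRSR arXiv:1402.7034, Thm. 3.1); `N ≥ 2`: the wave-level Doppler budget between strictly receding zones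
(leads c1/c2: mid-frame blended Killing fields, signed first-order wall bulk `multiplierBulk_eta_wall*`,
zeroth-order wall term) — with every near-horizon term removed by the red-shift (`stub_lateAssembly`).
[conjectural step of the line] -/
theorem stub_farEnergyBound_pos :
    ∀ N : ℕ, 0 < N → ∃ d₀ α v₀ : ℝ, 0 < d₀ ∧ 0 < α ∧ 0 < v₀ ∧
    ∀ (M a : Fin N → ℝ) (Λ : Fin N → lorentzGroup) (p : Fin N → E3) (u : Fin N → E4)
      (q : Fin N → E4 → E4),
      (∀ i, u i = (Λ i : E4 ≃L[ℝ] E4) (E4.basisVector 0)) →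
      (∀ i x, q i x = poincareInv (Λ i) (E4.ofTimeSpace 0 (p i)) x) →
      (∀ i, 0 < M i) → (∀ i, |a i| ≤ α * M i) →
      (∀ i, 0 < u i 0 ∧ ‖E4.spatial (u i)‖ ≤ v₀ * u i 0) →
      (∀ i j, i ≠ j → d₀ * (M i + M j) ≤ dist (p i) (p j) ∧
        0 < ⟪p i - p j, (u i 0)⁻¹ • E4.spatial (u i) - (u j 0)⁻¹ • E4.spatial (u j)⟫_ℝ) →
      ∀ (G : E4 → Fin 4 → Fin 4 → ℝ),
      (∀ x μ ν, G x μ ν = Minkowski.bilin (E4.basisVector μ) (E4.basisVector ν) -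
        ∑ i, Real.smoothTransition (2 - Kerr.radius (a i) (q i x) / (8 * M i)) *
          (2 * Kerr.scalarH (M i) (a i) (q i x)) *
          ((Λ i : E4 ≃L[ℝ] E4) (Kerr.nullVector (a i) (q i x))) μ *
          ((Λ i : E4 ≃L[ℝ] E4) (Kerr.nullVector (a i) (q i x))) ν) →
      ∀ (E : (E4 → ℝ) → ℝ → ENNReal),
      (∀ φ t, E φ t = ∫⁻ y in {y : E3 | ∀ i, Kerr.rPlus (M i) (a i) <
          Kerr.radius (a i) (q i (E4.ofTimeSpace t y))},
        ENNReal.ofReal (∑ μ : Fin 4, (fderiv ℝ φ (E4.ofTimeSpace t y) (E4.basisVector μ)) ^ 2)) →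
      ∀ η : ℝ, 0 < η → ∃ (t₁ : ℝ) (C : NNReal), ∀ ψ : E4 → ℝ, ContDiff ℝ ∞ ψ →
        (∀ x : E4, 0 ≤ x 0 → (∀ i, Kerr.rPlus (M i) (a i) < Kerr.radius (a i) (q i x)) →
          ∑ μ : Fin 4, fderiv ℝ (fun y ↦ ∑ ν : Fin 4, G y μ ν * fderiv ℝ ψ y (E4.basisVector ν)) x
            (E4.basisVector μ) = 0) →
        ∀ t : ℝ, t₁ ≤ t →
          ∫⁻ y in {y : E3 | ∀ i, Kerr.rPlus (M i) (a i) + η * M i ≤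
              Kerr.radius (a i) (q i (E4.ofTimeSpace t y))},
            ENNReal.ofReal (∑ μ : Fin 4, (fderiv ℝ ψ (E4.ofTimeSpace t y) (E4.basisVector μ)) ^ 2) ≤
          (C : ENNReal) * E ψ 0 := by
  sorry

/-- **(a), late-time form, `N ≥ 1`** — DERIVED from the four landed classical stubs and the research stub
`stub_farEnergyBound_pos` by the landed assembly `stub_lateAssembly`. [folklore] -/
theorem lateEnergyBound_pos :
    ∀ N : ℕ, 0 < N → ∃ d₀ α v₀ : ℝ, 0 < d₀ ∧ 0 < α ∧ 0 < v₀ ∧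
    ∀ (M a : Fin N → ℝ) (Λ : Fin N → lorentzGroup) (p : Fin N → E3) (u : Fin N → E4)
      (q : Fin N → E4 → E4),
      (∀ i, u i = (Λ i : E4 ≃L[ℝ] E4) (E4.basisVector 0)) →
      (∀ i x, q i x = poincareInv (Λ i) (E4.ofTimeSpace 0 (p i)) x) →
      (∀ i, 0 < M i) → (∀ i, |a i| ≤ α * M i) →
      (∀ i, 0 < u i 0 ∧ ‖E4.spatial (u i)‖ ≤ v₀ * u i 0) →
      (∀ i j, i ≠ j → d₀ * (M i + M j) ≤ dist (p i) (p j) ∧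
        0 < ⟪p i - p j, (u i 0)⁻¹ • E4.spatial (u i) - (u j 0)⁻¹ • E4.spatial (u j)⟫_ℝ) →
      ∀ (G : E4 → Fin 4 → Fin 4 → ℝ),
      (∀ x μ ν, G x μ ν = Minkowski.bilin (E4.basisVector μ) (E4.basisVector ν) -
        ∑ i, Real.smoothTransition (2 - Kerr.radius (a i) (q i x) / (8 * M i)) *
          (2 * Kerr.scalarH (M i) (a i) (q i x)) *
          ((Λ i : E4 ≃L[ℝ] E4) (Kerr.nullVector (a i) (q i x))) μ *
          ((Λ i : E4 ≃L[ℝ] E4) (Kerr.nullVector (a i) (q i x))) ν) →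
      ∀ (E : (E4 → ℝ) → ℝ → ENNReal),
      (∀ φ t, E φ t = ∫⁻ y in {y : E3 | ∀ i, Kerr.rPlus (M i) (a i) <
          Kerr.radius (a i) (q i (E4.ofTimeSpace t y))},
        ENNReal.ofReal (∑ μ : Fin 4, (fderiv ℝ φ (E4.ofTimeSpace t y) (E4.basisVector μ)) ^ 2)) →
      ∃ (t₁ : ℝ) (C : NNReal), ∀ ψ : E4 → ℝ, ContDiff ℝ ∞ ψ →
        (∀ x : E4, 0 ≤ x 0 → (∀ i, Kerr.rPlus (M i) (a i) < Kerr.radius (a i) (q i x)) →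
          ∑ μ : Fin 4, fderiv ℝ (fun y ↦ ∑ ν : Fin 4, G y μ ν * fderiv ℝ ψ y (E4.basisVector ν)) x
            (E4.basisVector μ) = 0) →
        ∀ t : ℝ, t₁ ≤ t → E ψ t ≤ (C : ENNReal) * E ψ 0 :=
  stub_lateAssembly stub_redShiftLocal stub_zonePullbackWave stub_sliceLeafCorrespondence
    stub_boundedOfIntegralIneq stub_farEnergyBound_pos

/-- **(a), late-time form** (all `N`): by cases on `N` from `stub_lateEnergyBound_zero` and
`stub_lateEnergyBound_pos`. [folklore] -/
theorem lateEnergyBound :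
    ∀ N : ℕ, ∃ d₀ α v₀ : ℝ, 0 < d₀ ∧ 0 < α ∧ 0 < v₀ ∧
    ∀ (M a : Fin N → ℝ) (Λ : Fin N → lorentzGroup) (p : Fin N → E3) (u : Fin N → E4)
      (q : Fin N → E4 → E4),
      (∀ i, u i = (Λ i : E4 ≃L[ℝ] E4) (E4.basisVector 0)) →
      (∀ i x, q i x = poincareInv (Λ i) (E4.ofTimeSpace 0 (p i)) x) →
      (∀ i, 0 < M i) → (∀ i, |a i| ≤ α * M i) →
      (∀ i, 0 < u i 0 ∧ ‖E4.spatial (u i)‖ ≤ v₀ * u i 0) →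
      (∀ i j, i ≠ j → d₀ * (M i + M j) ≤ dist (p i) (p j) ∧
        0 < ⟪p i - p j, (u i 0)⁻¹ • E4.spatial (u i) - (u j 0)⁻¹ • E4.spatial (u j)⟫_ℝ) →
      ∀ (G : E4 → Fin 4 → Fin 4 → ℝ),
      (∀ x μ ν, G x μ ν = Minkowski.bilin (E4.basisVector μ) (E4.basisVector ν) -
        ∑ i, Real.smoothTransition (2 - Kerr.radius (a i) (q i x) / (8 * M i)) *
          (2 * Kerr.scalarH (M i) (a i) (q i x)) *
          ((Λ i : E4 ≃L[ℝ] E4) (Kerr.nullVector (a i) (q i x))) μ *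
          ((Λ i : E4 ≃L[ℝ] E4) (Kerr.nullVector (a i) (q i x))) ν) →
      ∀ (E : (E4 → ℝ) → ℝ → ENNReal),
      (∀ φ t, E φ t = ∫⁻ y in {y : E3 | ∀ i, Kerr.rPlus (M i) (a i) <
          Kerr.radius (a i) (q i (E4.ofTimeSpace t y))},
        ENNReal.ofReal (∑ μ : Fin 4, (fderiv ℝ φ (E4.ofTimeSpace t y) (E4.basisVector μ)) ^ 2)) →
      ∃ (t₁ : ℝ) (C : NNReal), ∀ ψ : E4 → ℝ, ContDiff ℝ ∞ ψ →
        (∀ x : E4, 0 ≤ x 0 → (∀ i, Kerr.rPlus (M i) (a i) < Kerr.radius (a i) (q i x)) →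
          ∑ μ : Fin 4, fderiv ℝ (fun y ↦ ∑ ν : Fin 4, G y μ ν * fderiv ℝ ψ y (E4.basisVector ν)) x
            (E4.basisVector μ) = 0) →
        ∀ t : ℝ, t₁ ≤ t → E ψ t ≤ (C : ENNReal) * E ψ 0 := by
  intro N
  rcases Nat.eq_zero_or_pos N with rfl | hN
  · exact stub_lateEnergyBound_zero
  · exact lateEnergyBound_pos N hN

/-- **(a) Uniform energy boundedness from the finite-time growth bound and the late-time stub**:
`C := max C_late (K e^{K max(t₁,0)})`, thresholds reconciled by `max / min`. [folklore] -/
theorem energyBound_of_finiteTime_late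
    (hFT : ∀ (N : ℕ) (M a : Fin N → ℝ) (Λ : Fin N → lorentzGroup) (p : Fin N → E3) (u : Fin N → E4)
      (q : Fin N → E4 → E4),
      (∀ i, u i = (Λ i : E4 ≃L[ℝ] E4) (E4.basisVector 0)) →
      (∀ i x, q i x = poincareInv (Λ i) (E4.ofTimeSpace 0 (p i)) x) →
      (∀ i, 0 < M i) → (∀ i, |a i| ≤ 2⁻¹ * M i) →
      (∀ i, 0 < u i 0 ∧ ‖E4.spatial (u i)‖ ≤ 2⁻¹ * u i 0) →
      (∀ i j, i ≠ j → 40 * (M i + M j) ≤ dist (p i) (p j) ∧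
        0 < ⟪p i - p j, (u i 0)⁻¹ • E4.spatial (u i) - (u j 0)⁻¹ • E4.spatial (u j)⟫_ℝ) →
      ∀ (G : E4 → Fin 4 → Fin 4 → ℝ),
      (∀ x μ ν, G x μ ν = Minkowski.bilin (E4.basisVector μ) (E4.basisVector ν) -
        ∑ i, Real.smoothTransition (2 - Kerr.radius (a i) (q i x) / (8 * M i)) *
          (2 * Kerr.scalarH (M i) (a i) (q i x)) *
          ((Λ i : E4 ≃L[ℝ] E4) (Kerr.nullVector (a i) (q i x))) μ *
          ((Λ i : E4 ≃L[ℝ] E4) (Kerr.nullVector (a i) (q i x))) ν) →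
      ∀ (E : (E4 → ℝ) → ℝ → ENNReal),
      (∀ φ t, E φ t = ∫⁻ y in {y : E3 | ∀ i, Kerr.rPlus (M i) (a i) <
          Kerr.radius (a i) (q i (E4.ofTimeSpace t y))},
        ENNReal.ofReal (∑ μ : Fin 4, (fderiv ℝ φ (E4.ofTimeSpace t y) (E4.basisVector μ)) ^ 2)) →
      ∃ K : ℝ, 0 ≤ K ∧ ∀ ψ : E4 → ℝ, ContDiff ℝ ∞ ψ →
        (∀ x : E4, 0 ≤ x 0 → (∀ i, Kerr.rPlus (M i) (a i) < Kerr.radius (a i) (q i x)) →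
          ∑ μ : Fin 4, fderiv ℝ (fun y ↦ ∑ ν : Fin 4, G y μ ν * fderiv ℝ ψ y (E4.basisVector ν)) x
            (E4.basisVector μ) = 0) →
        ∀ t : ℝ, 0 ≤ t → E ψ t ≤ ENNReal.ofReal (K * Real.exp (K * t)) * E ψ 0)
    (hLT : ∀ N : ℕ, ∃ d₀ α v₀ : ℝ, 0 < d₀ ∧ 0 < α ∧ 0 < v₀ ∧
    ∀ (M a : Fin N → ℝ) (Λ : Fin N → lorentzGroup) (p : Fin N → E3) (u : Fin N → E4)
      (q : Fin N → E4 → E4),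
      (∀ i, u i = (Λ i : E4 ≃L[ℝ] E4) (E4.basisVector 0)) →
      (∀ i x, q i x = poincareInv (Λ i) (E4.ofTimeSpace 0 (p i)) x) →
      (∀ i, 0 < M i) → (∀ i, |a i| ≤ α * M i) →
      (∀ i, 0 < u i 0 ∧ ‖E4.spatial (u i)‖ ≤ v₀ * u i 0) →
      (∀ i j, i ≠ j → d₀ * (M i + M j) ≤ dist (p i) (p j) ∧
        0 < ⟪p i - p j, (u i 0)⁻¹ • E4.spatial (u i) - (u j 0)⁻¹ • E4.spatial (u j)⟫_ℝ) →
      ∀ (G : E4 → Fin 4 → Fin 4 → ℝ),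
      (∀ x μ ν, G x μ ν = Minkowski.bilin (E4.basisVector μ) (E4.basisVector ν) -
        ∑ i, Real.smoothTransition (2 - Kerr.radius (a i) (q i x) / (8 * M i)) *
          (2 * Kerr.scalarH (M i) (a i) (q i x)) *
          ((Λ i : E4 ≃L[ℝ] E4) (Kerr.nullVector (a i) (q i x))) μ *
          ((Λ i : E4 ≃L[ℝ] E4) (Kerr.nullVector (a i) (q i x))) ν) →
      ∀ (E : (E4 → ℝ) → ℝ → ENNReal),
      (∀ φ t, E φ t = ∫⁻ y in {y : E3 | ∀ i, Kerr.rPlus (M i) (a i) <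
          Kerr.radius (a i) (q i (E4.ofTimeSpace t y))},
        ENNReal.ofReal (∑ μ : Fin 4, (fderiv ℝ φ (E4.ofTimeSpace t y) (E4.basisVector μ)) ^ 2)) →
      ∃ (t₁ : ℝ) (C : NNReal), ∀ ψ : E4 → ℝ, ContDiff ℝ ∞ ψ →
        (∀ x : E4, 0 ≤ x 0 → (∀ i, Kerr.rPlus (M i) (a i) < Kerr.radius (a i) (q i x)) →
          ∑ μ : Fin 4, fderiv ℝ (fun y ↦ ∑ ν : Fin 4, G y μ ν * fderiv ℝ ψ y (E4.basisVector ν)) x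
            (E4.basisVector μ) = 0) →
        ∀ t : ℝ, t₁ ≤ t → E ψ t ≤ (C : ENNReal) * E ψ 0) :
    ∀ N : ℕ, ∃ d₀ α v₀ : ℝ, 0 < d₀ ∧ 0 < α ∧ 0 < v₀ ∧
    ∀ (M a : Fin N → ℝ) (Λ : Fin N → lorentzGroup) (p : Fin N → E3) (u : Fin N → E4)
      (q : Fin N → E4 → E4),
      (∀ i, u i = (Λ i : E4 ≃L[ℝ] E4) (E4.basisVector 0)) →
      (∀ i x, q i x = poincareInv (Λ i) (E4.ofTimeSpace 0 (p i)) x) →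
      (∀ i, 0 < M i) → (∀ i, |a i| ≤ α * M i) →
      (∀ i, 0 < u i 0 ∧ ‖E4.spatial (u i)‖ ≤ v₀ * u i 0) →
      (∀ i j, i ≠ j → d₀ * (M i + M j) ≤ dist (p i) (p j) ∧
        0 < ⟪p i - p j, (u i 0)⁻¹ • E4.spatial (u i) - (u j 0)⁻¹ • E4.spatial (u j)⟫_ℝ) →
      ∀ (G : E4 → Fin 4 → Fin 4 → ℝ),
      (∀ x μ ν, G x μ ν = Minkowski.bilin (E4.basisVector μ) (E4.basisVector ν) -
        ∑ i, Real.smoothTransition (2 - Kerr.radius (a i) (q i x) / (8 * M i)) *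
          (2 * Kerr.scalarH (M i) (a i) (q i x)) *
          ((Λ i : E4 ≃L[ℝ] E4) (Kerr.nullVector (a i) (q i x))) μ *
          ((Λ i : E4 ≃L[ℝ] E4) (Kerr.nullVector (a i) (q i x))) ν) →
      ∀ (E : (E4 → ℝ) → ℝ → ENNReal),
      (∀ φ t, E φ t = ∫⁻ y in {y : E3 | ∀ i, Kerr.rPlus (M i) (a i) <
          Kerr.radius (a i) (q i (E4.ofTimeSpace t y))},
        ENNReal.ofReal (∑ μ : Fin 4, (fderiv ℝ φ (E4.ofTimeSpace t y) (E4.basisVector μ)) ^ 2)) →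
      ∃ C : NNReal, ∀ ψ : E4 → ℝ, ContDiff ℝ ∞ ψ →
        (∀ x : E4, 0 ≤ x 0 → (∀ i, Kerr.rPlus (M i) (a i) < Kerr.radius (a i) (q i x)) →
          ∑ μ : Fin 4, fderiv ℝ (fun y ↦ ∑ ν : Fin 4, G y μ ν * fderiv ℝ ψ y (E4.basisVector ν)) x
            (E4.basisVector μ) = 0) →
        ∀ t : ℝ, 0 ≤ t → E ψ t ≤ (C : ENNReal) * E ψ 0 := by
  intro N
  obtain ⟨d₀, α, v₀, hd₀, hα, hv₀, H⟩ := hLT N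
  refine ⟨max d₀ 40, min α 2⁻¹, min v₀ 2⁻¹, lt_max_of_lt_left hd₀, lt_min hα (by norm_num),
    lt_min hv₀ (by norm_num), ?_⟩
  intro M a Λ p u q hu hq hM ha hv hsep G hG E hE
  have ha₁ : ∀ i, |a i| ≤ α * M i := fun i ↦
    (ha i).trans (mul_le_mul_of_nonneg_right (min_le_left _ _) (hM i).le)
  have ha₂ : ∀ i, |a i| ≤ 2⁻¹ * M i := fun i ↦
    (ha i).trans (mul_le_mul_of_nonneg_right (min_le_right _ _) (hM i).le)
  have hv₁ : ∀ i, 0 < u i 0 ∧ ‖E4.spatial (u i)‖ ≤ v₀ * u i 0 := fun i ↦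
    ⟨(hv i).1, (hv i).2.trans (mul_le_mul_of_nonneg_right (min_le_left _ _) (hv i).1.le)⟩
  have hv₂ : ∀ i, 0 < u i 0 ∧ ‖E4.spatial (u i)‖ ≤ 2⁻¹ * u i 0 := fun i ↦
    ⟨(hv i).1, (hv i).2.trans (mul_le_mul_of_nonneg_right (min_le_right _ _) (hv i).1.le)⟩
  have hsep₁ : ∀ i j, i ≠ j → d₀ * (M i + M j) ≤ dist (p i) (p j) ∧
      0 < ⟪p i - p j, (u i 0)⁻¹ • E4.spatial (u i) - (u j 0)⁻¹ • E4.spatial (u j)⟫_ℝ :=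
    fun i j hij ↦ ⟨(mul_le_mul_of_nonneg_right (le_max_left _ _) (add_pos (hM i) (hM j)).le).trans
      (hsep i j hij).1, (hsep i j hij).2⟩
  have hsep₂ : ∀ i j, i ≠ j → 40 * (M i + M j) ≤ dist (p i) (p j) ∧
      0 < ⟪p i - p j, (u i 0)⁻¹ • E4.spatial (u i) - (u j 0)⁻¹ • E4.spatial (u j)⟫_ℝ :=
    fun i j hij ↦ ⟨(mul_le_mul_of_nonneg_right (le_max_right _ _) (add_pos (hM i) (hM j)).le).trans
      (hsep i j hij).1, (hsep i j hij).2⟩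
  obtain ⟨t₁, C, HC⟩ := H M a Λ p u q hu hq hM ha₁ hv₁ hsep₁ G hG E hE
  obtain ⟨K, hK0, HK⟩ := hFT N M a Λ p u q hu hq hM ha₂ hv₂ hsep₂ G hG E hE
  set K₁ : NNReal := Real.toNNReal (K * Real.exp (K * max t₁ 0)) with hK₁
  refine ⟨max C K₁, fun ψ hψ hsol t ht ↦ ?_⟩
  rcases le_or_gt t₁ t with h | h
  · refine (HC ψ hψ hsol t h).trans ?_
    gcongr
    exact_mod_cast le_max_left _ _
  · refine (HK ψ hψ hsol t ht).trans ?_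
    gcongr
    have hmono : K * Real.exp (K * t) ≤ K * Real.exp (K * max t₁ 0) := by
      apply mul_le_mul_of_nonneg_left _ hK0
      exact Real.exp_le_exp.mpr (mul_le_mul_of_nonneg_left (h.le.trans (le_max_left _ _)) hK0)
    calc ENNReal.ofReal (K * Real.exp (K * t))
        ≤ ENNReal.ofReal (K * Real.exp (K * max t₁ 0)) := ENNReal.ofReal_le_ofReal hmono
      _ = (K₁ : ENNReal) := by rw [hK₁, ENNReal.ofReal]
      _ ≤ ((max C K₁ : NNReal) : ENNReal) := by exact_mod_cast le_max_right _ _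

/-- **(a) Uniform energy boundedness** on the tails-cut, strictly receding patched multi-Kerr
background, `E[ψ](t) ≤ C E[ψ](0)` for `t ≥ 0`: from the classical finite-time growth bound
(`stub_finiteTimeEnergy`, proved in `Theorems/…FiniteTimeEnergy.lean` from the landed `stub_cruxFieldPointwise`,
`stub_slabWeight`, `stub_slabGronwall`) and the late-time research stub `stub_lateEnergyBound`. [folklore] -/
theorem energyBound :
    ∀ N : ℕ, ∃ d₀ α v₀ : ℝ, 0 < d₀ ∧ 0 < α ∧ 0 < v₀ ∧
    ∀ (M a : Fin N → ℝ) (Λ : Fin N → lorentzGroup) (p : Fin N → E3) (u : Fin N → E4)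
      (q : Fin N → E4 → E4),
      (∀ i, u i = (Λ i : E4 ≃L[ℝ] E4) (E4.basisVector 0)) →
      (∀ i x, q i x = poincareInv (Λ i) (E4.ofTimeSpace 0 (p i)) x) →
      (∀ i, 0 < M i) → (∀ i, |a i| ≤ α * M i) →
      (∀ i, 0 < u i 0 ∧ ‖E4.spatial (u i)‖ ≤ v₀ * u i 0) →
      (∀ i j, i ≠ j → d₀ * (M i + M j) ≤ dist (p i) (p j) ∧
        0 < ⟪p i - p j, (u i 0)⁻¹ • E4.spatial (u i) - (u j 0)⁻¹ • E4.spatial (u j)⟫_ℝ) →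
      ∀ (G : E4 → Fin 4 → Fin 4 → ℝ),
      (∀ x μ ν, G x μ ν = Minkowski.bilin (E4.basisVector μ) (E4.basisVector ν) -
        ∑ i, Real.smoothTransition (2 - Kerr.radius (a i) (q i x) / (8 * M i)) *
          (2 * Kerr.scalarH (M i) (a i) (q i x)) *
          ((Λ i : E4 ≃L[ℝ] E4) (Kerr.nullVector (a i) (q i x))) μ *
          ((Λ i : E4 ≃L[ℝ] E4) (Kerr.nullVector (a i) (q i x))) ν) →
      ∀ (E : (E4 → ℝ) → ℝ → ENNReal),
      (∀ φ t, E φ t = ∫⁻ y in {y : E3 | ∀ i, Kerr.rPlus (M i) (a i) <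
          Kerr.radius (a i) (q i (E4.ofTimeSpace t y))},
        ENNReal.ofReal (∑ μ : Fin 4, (fderiv ℝ φ (E4.ofTimeSpace t y) (E4.basisVector μ)) ^ 2)) →
      ∃ C : NNReal, ∀ ψ : E4 → ℝ, ContDiff ℝ ∞ ψ →
        (∀ x : E4, 0 ≤ x 0 → (∀ i, Kerr.rPlus (M i) (a i) < Kerr.radius (a i) (q i x)) →
          ∑ μ : Fin 4, fderiv ℝ (fun y ↦ ∑ ν : Fin 4, G y μ ν * fderiv ℝ ψ y (E4.basisVector ν)) x
            (E4.basisVector μ) = 0) →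
        ∀ t : ℝ, 0 ≤ t → E ψ t ≤ (C : ENNReal) * E ψ 0 :=
  energyBound_of_finiteTime_late stub_finiteTimeEnergy lateEnergyBound

/-- **Near-zone integrated decay with loss of one derivative, `N ≥ 1`**, first and zeroth order: for the
solution normalised by its constant at infinity `c` (`ψ(0,·) − c` in the Hardy class far out), the
space-time integral over the moving zones `{rᵢ < 64Mᵢ} ∩ {exterior}` of `|∂ψ|² + (ψ − c)²/Mᵢ²` is
bounded by `C (E[ψ](0) + E[∂ₜψ](0))`. `N = 1`: Dafermos–Rodnianski(–Shlapentokh-Rothman) technology for the tails-cut boosted zone in the lab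
foliation; `N ≥ 2`: plus the inter-zone renewal/Doppler budget. [conjectural step of the line] -/
theorem stub_nearZoneILED_pos :
    ∀ N : ℕ, 0 < N → ∃ d₀ α v₀ : ℝ, 0 < d₀ ∧ 0 < α ∧ 0 < v₀ ∧
    ∀ (M a : Fin N → ℝ) (Λ : Fin N → lorentzGroup) (p : Fin N → E3) (u : Fin N → E4)
      (q : Fin N → E4 → E4),
      (∀ i, u i = (Λ i : E4 ≃L[ℝ] E4) (E4.basisVector 0)) →
      (∀ i x, q i x = poincareInv (Λ i) (E4.ofTimeSpace 0 (p i)) x) →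
      (∀ i, 0 < M i) → (∀ i, |a i| ≤ α * M i) →
      (∀ i, 0 < u i 0 ∧ ‖E4.spatial (u i)‖ ≤ v₀ * u i 0) →
      (∀ i j, i ≠ j → d₀ * (M i + M j) ≤ dist (p i) (p j) ∧
        0 < ⟪p i - p j, (u i 0)⁻¹ • E4.spatial (u i) - (u j 0)⁻¹ • E4.spatial (u j)⟫_ℝ) →
      ∀ (G : E4 → Fin 4 → Fin 4 → ℝ),
      (∀ x μ ν, G x μ ν = Minkowski.bilin (E4.basisVector μ) (E4.basisVector ν) -
        ∑ i, Real.smoothTransition (2 - Kerr.radius (a i) (q i x) / (8 * M i)) *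
          (2 * Kerr.scalarH (M i) (a i) (q i x)) *
          ((Λ i : E4 ≃L[ℝ] E4) (Kerr.nullVector (a i) (q i x))) μ *
          ((Λ i : E4 ≃L[ℝ] E4) (Kerr.nullVector (a i) (q i x))) ν) →
      ∀ (E : (E4 → ℝ) → ℝ → ENNReal),
      (∀ φ t, E φ t = ∫⁻ y in {y : E3 | ∀ i, Kerr.rPlus (M i) (a i) <
          Kerr.radius (a i) (q i (E4.ofTimeSpace t y))},
        ENNReal.ofReal (∑ μ : Fin 4, (fderiv ℝ φ (E4.ofTimeSpace t y) (E4.basisVector μ)) ^ 2)) →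
      ∃ C : NNReal, ∀ ψ : E4 → ℝ, ContDiff ℝ ∞ ψ →
        (∀ x : E4, 0 ≤ x 0 → (∀ i, Kerr.rPlus (M i) (a i) < Kerr.radius (a i) (q i x)) →
          ∑ μ : Fin 4, fderiv ℝ (fun y ↦ ∑ ν : Fin 4, G y μ ν * fderiv ℝ ψ y (E4.basisVector ν)) x
            (E4.basisVector μ) = 0) →
        ∀ c : ℝ, (∃ ρ : ℝ, ∫⁻ y in {y : E3 | ρ < ‖y‖},
            ENNReal.ofReal ((ψ (E4.ofTimeSpace 0 y) - c) ^ 2 / ‖y‖ ^ 2) < ⊤) →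
        ∀ i, ∫⁻ t in Set.Ioi (0 : ℝ), ∫⁻ y in {y : E3 | Kerr.radius (a i) (q i (E4.ofTimeSpace t y)) < 64 * M i ∧
            ∀ j, Kerr.rPlus (M j) (a j) < Kerr.radius (a j) (q j (E4.ofTimeSpace t y))},
            (ENNReal.ofReal (∑ μ : Fin 4, (fderiv ℝ ψ (E4.ofTimeSpace t y) (E4.basisVector μ)) ^ 2) +
              ENNReal.ofReal ((ψ (E4.ofTimeSpace t y) - c) ^ 2 / (M i) ^ 2)) ≤
          (C : ENNReal) * (E ψ 0 + E (fun x ↦ fderiv ℝ ψ x (E4.basisVector 0)) 0) := by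
  sorry

/-- **Near-zone integrated decay** (all `N`): for `N = 0` there are no zones and the statement is
vacuous (`Fin 0` is empty); for `N ≥ 1` it is `stub_nearZoneILED_pos`. [folklore] -/
theorem nearZoneILED :
    ∀ N : ℕ, ∃ d₀ α v₀ : ℝ, 0 < d₀ ∧ 0 < α ∧ 0 < v₀ ∧
    ∀ (M a : Fin N → ℝ) (Λ : Fin N → lorentzGroup) (p : Fin N → E3) (u : Fin N → E4)
      (q : Fin N → E4 → E4),
      (∀ i, u i = (Λ i : E4 ≃L[ℝ] E4) (E4.basisVector 0)) →
      (∀ i x, q i x = poincareInv (Λ i) (E4.ofTimeSpace 0 (p i)) x) →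
      (∀ i, 0 < M i) → (∀ i, |a i| ≤ α * M i) →
      (∀ i, 0 < u i 0 ∧ ‖E4.spatial (u i)‖ ≤ v₀ * u i 0) →
      (∀ i j, i ≠ j → d₀ * (M i + M j) ≤ dist (p i) (p j) ∧
        0 < ⟪p i - p j, (u i 0)⁻¹ • E4.spatial (u i) - (u j 0)⁻¹ • E4.spatial (u j)⟫_ℝ) →
      ∀ (G : E4 → Fin 4 → Fin 4 → ℝ),
      (∀ x μ ν, G x μ ν = Minkowski.bilin (E4.basisVector μ) (E4.basisVector ν) -
        ∑ i, Real.smoothTransition (2 - Kerr.radius (a i) (q i x) / (8 * M i)) *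
          (2 * Kerr.scalarH (M i) (a i) (q i x)) *
          ((Λ i : E4 ≃L[ℝ] E4) (Kerr.nullVector (a i) (q i x))) μ *
          ((Λ i : E4 ≃L[ℝ] E4) (Kerr.nullVector (a i) (q i x))) ν) →
      ∀ (E : (E4 → ℝ) → ℝ → ENNReal),
      (∀ φ t, E φ t = ∫⁻ y in {y : E3 | ∀ i, Kerr.rPlus (M i) (a i) <
          Kerr.radius (a i) (q i (E4.ofTimeSpace t y))},
        ENNReal.ofReal (∑ μ : Fin 4, (fderiv ℝ φ (E4.ofTimeSpace t y) (E4.basisVector μ)) ^ 2)) →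
      ∃ C : NNReal, ∀ ψ : E4 → ℝ, ContDiff ℝ ∞ ψ →
        (∀ x : E4, 0 ≤ x 0 → (∀ i, Kerr.rPlus (M i) (a i) < Kerr.radius (a i) (q i x)) →
          ∑ μ : Fin 4, fderiv ℝ (fun y ↦ ∑ ν : Fin 4, G y μ ν * fderiv ℝ ψ y (E4.basisVector ν)) x
            (E4.basisVector μ) = 0) →
        ∀ c : ℝ, (∃ ρ : ℝ, ∫⁻ y in {y : E3 | ρ < ‖y‖},
            ENNReal.ofReal ((ψ (E4.ofTimeSpace 0 y) - c) ^ 2 / ‖y‖ ^ 2) < ⊤) →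
        ∀ i, ∫⁻ t in Set.Ioi (0 : ℝ), ∫⁻ y in {y : E3 | Kerr.radius (a i) (q i (E4.ofTimeSpace t y)) < 64 * M i ∧
            ∀ j, Kerr.rPlus (M j) (a j) < Kerr.radius (a j) (q j (E4.ofTimeSpace t y))},
            (ENNReal.ofReal (∑ μ : Fin 4, (fderiv ℝ ψ (E4.ofTimeSpace t y) (E4.basisVector μ)) ^ 2) +
              ENNReal.ofReal ((ψ (E4.ofTimeSpace t y) - c) ^ 2 / (M i) ^ 2)) ≤
          (C : ENNReal) * (E ψ 0 + E (fun x ↦ fderiv ℝ ψ x (E4.basisVector 0)) 0) := by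
  intro N
  rcases Nat.eq_zero_or_pos N with rfl | hN
  · refine ⟨1, 1, 1, one_pos, one_pos, one_pos, ?_⟩
    intro M a Λ p u q _ _ _ _ _ _ G _ E _
    exact ⟨0, fun ψ _ _ c _ i ↦ i.elim0⟩
  · exact stub_nearZoneILED_pos N hN

/-! ### Helpers for the composition (normalising constant at `t = 0`) -/

/-- `‖ℓ ∘ (0, ·)‖² ≤ ∑_μ ℓ(∂_μ)²` for a functional on `E4`: the slice gradient is bounded by the full
coordinate gradient. [folklore] -/
theorem norm_comp_spaceEmbed_sq_le (ℓ : E4 →L[ℝ] ℝ) :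
    ‖ℓ.comp E4.spaceEmbed‖ ^ 2 ≤ ∑ μ : Fin 4, (ℓ (E4.basisVector μ)) ^ 2 := by
  set A : ℝ := Real.sqrt (∑ m : Fin 3, (ℓ (E4.basisVector m.succ)) ^ 2) with hA
  have hA0 : 0 ≤ A := Real.sqrt_nonneg _
  have hbound : ∀ v : E3, ‖ℓ.comp E4.spaceEmbed v‖ ≤ A * ‖v‖ := by
    intro v
    rw [ContinuousLinearMap.comp_apply, E4.spaceEmbed_eq_sum, map_sum, Real.norm_eq_abs]
    simp only [map_smul, smul_eq_mul]
    have hcs := Finset.sum_mul_sq_le_sq_mul_sq Finset.univ (fun m : Fin 3 ↦ v m)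
      (fun m ↦ ℓ (E4.basisVector m.succ))
    have hv : ‖v‖ = Real.sqrt (∑ m : Fin 3, (v m) ^ 2) := by
      rw [EuclideanSpace.norm_eq]
      simp [Real.norm_eq_abs, sq_abs]
    rw [hv, hA, ← Real.sqrt_mul (Finset.sum_nonneg fun _ _ ↦ sq_nonneg _), ← Real.sqrt_sq_eq_abs]
    exact Real.sqrt_le_sqrt (by nlinarith [hcs])
  have hop : ‖ℓ.comp E4.spaceEmbed‖ ≤ A := ContinuousLinearMap.opNorm_le_bound _ hA0 hbound
  have hsq : ‖ℓ.comp E4.spaceEmbed‖ ^ 2 ≤ A ^ 2 := pow_le_pow_left₀ (norm_nonneg _) hop 2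
  rw [hA, Real.sq_sqrt (Finset.sum_nonneg fun _ _ ↦ sq_nonneg _)] at hsq
  refine hsq.trans ?_
  conv_rhs => rw [Fin.sum_univ_succ]
  nlinarith [sq_nonneg (ℓ (E4.basisVector 0))]

/-- The differential of the slice function `y ↦ ψ(0, y)` is `dψ ∘ (0, ·)`. [folklore] -/
theorem fderiv_slice_eq {ψ : E4 → ℝ} {y : E3} (hψ : DifferentiableAt ℝ ψ (E4.ofTimeSpace 0 y)) :
    fderiv ℝ (fun z : E3 ↦ ψ (E4.ofTimeSpace 0 z)) y =
      (fderiv ℝ ψ (E4.ofTimeSpace 0 y)).comp E4.spaceEmbed :=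
  (hψ.hasFDerivAt.comp y (E4.hasFDerivAt_ofTimeSpace 0 y)).fderiv

/-- `ρ² − a² ≤ r²` for the Kerr–Schild radius (`r² = ((ρ² − a²) + √D)/2`, `√D ≥ |ρ² − a²|`).
[folklore] -/
theorem spatialNorm_sq_sub_sq_le_radius_sq (a : ℝ) (z : E4) :
    E4.spatialNorm z ^ 2 - a ^ 2 ≤ Kerr.radius a z ^ 2 := by
  rw [Kerr.radius_sq]
  have h := Kerr.abs_le_sqrt_radius_discr a z
  have h' := le_abs_self (E4.spatialNorm z ^ 2 - a ^ 2)
  linarith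

/-- `r₊ ≤ 2M` for `M ≥ 0`. [folklore] -/
theorem rPlus_le_two_mul {M : ℝ} (hM : 0 ≤ M) (a : ℝ) : Kerr.rPlus M a ≤ 2 * M := by
  unfold Kerr.rPlus
  have : Real.sqrt (M ^ 2 - a ^ 2) ≤ M := by
    calc Real.sqrt (M ^ 2 - a ^ 2) ≤ Real.sqrt (M ^ 2) :=
          Real.sqrt_le_sqrt (sub_le_self _ (sq_nonneg a))
      _ = M := Real.sqrt_sq hM
  linarith

/-- **Far out at `t = 0` every point is exterior to every hole**: if `‖pᵢ‖ + 3Mᵢ ≤ R₀ < ‖y‖` and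
`|aᵢ| ≤ Mᵢ`, then `r₊ᵢ < rᵢ(0, y)` (zone kinematics at `t = 0`: `‖y − pᵢ‖ ≤ |z⃗ᵢ|`, and
`|z⃗|² − a² ≤ r²`). [folklore] -/
theorem rPlus_lt_radius_of_far
    (hZG : ∀ (Λ : lorentzGroup) (p : E3) (u : E4) (q : E4 → E4),
      u = (Λ : E4 ≃L[ℝ] E4) (E4.basisVector 0) →
      (∀ x, q x = poincareInv Λ (E4.ofTimeSpace 0 p) x) → 0 < u 0 →
      ∀ (t : ℝ) (y : E3),
        ‖y - p - (t * (u 0)⁻¹) • E4.spatial u‖ ^ 2 ≤ E4.spatialNorm (q (E4.ofTimeSpace t y)) ^ 2 ∧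
        E4.spatialNorm (q (E4.ofTimeSpace t y)) ^ 2 ≤
          (u 0) ^ 2 * ‖y - p - (t * (u 0)⁻¹) • E4.spatial u‖ ^ 2)
    {Λi : lorentzGroup} {pi : E3} {ui : E4} {qi : E4 → E4} {Mi ai R₀ : ℝ}
    (hu : ui = (Λi : E4 ≃L[ℝ] E4) (E4.basisVector 0))
    (hq : ∀ x, qi x = poincareInv Λi (E4.ofTimeSpace 0 pi) x) (hu0 : 0 < ui 0)
    (hM : 0 < Mi) (ha : |ai| ≤ Mi) (hR₀ : ‖pi‖ + 3 * Mi ≤ R₀) {y : E3} (hy : R₀ < ‖y‖) :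
    Kerr.rPlus Mi ai < Kerr.radius ai (qi (E4.ofTimeSpace 0 y)) := by
  have hkin := (hZG Λi pi ui qi hu hq hu0 0 y).1
  simp only [zero_mul, zero_smul, sub_zero] at hkin
  have hr := spatialNorm_sq_sub_sq_le_radius_sq ai (qi (E4.ofTimeSpace 0 y))
  have ha2 : ai ^ 2 ≤ Mi ^ 2 := by
    have : |ai| ≤ |Mi| := ha.trans (le_abs_self Mi)
    exact sq_le_sq.mpr this
  have hyp : 3 * Mi < ‖y - pi‖ := by
    have := norm_sub_norm_le y pi
    linarith
  have hyp2 : (3 * Mi) ^ 2 < ‖y - pi‖ ^ 2 := by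
    exact pow_lt_pow_left₀ hyp (by linarith) two_ne_zero
  have hrp := rPlus_le_two_mul hM.le ai
  have hrp0 : 0 ≤ Kerr.rPlus Mi ai := by
    unfold Kerr.rPlus; positivity
  have hsq : Kerr.rPlus Mi ai ^ 2 < Kerr.radius ai (qi (E4.ofTimeSpace 0 y)) ^ 2 := by
    have h4 : Kerr.rPlus Mi ai ^ 2 ≤ (2 * Mi) ^ 2 := pow_le_pow_left₀ hrp0 hrp 2
    nlinarith
  exact lt_of_pow_lt_pow_left₀ 2 (Kerr.radius_nonneg _ _) hsq

/-- **Composition with explicit hypotheses** (the seven stub STATEMENTS imply the crux). The conclusion is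
wrapped in `id` so that the skeleton audit's crux-concluding theorem is the hypothesis-free
`AdiabaticMultiKerrILED_of` below (a crux-concluding theorem with binders is `skeleton.extra-hypothesis`). -/
theorem adiabaticMultiKerrILED_of_statements
    (hZG : ∀ (Λ : lorentzGroup) (p : E3) (u : E4) (q : E4 → E4),
        u = (Λ : E4 ≃L[ℝ] E4) (E4.basisVector 0) →
        (∀ x, q x = poincareInv Λ (E4.ofTimeSpace 0 p) x) → 0 < u 0 →
        ∀ (t : ℝ) (y : E3),
          ‖y - p - (t * (u 0)⁻¹) • E4.spatial u‖ ^ 2 ≤ E4.spatialNorm (q (E4.ofTimeSpace t y)) ^ 2 ∧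
          E4.spatialNorm (q (E4.ofTimeSpace t y)) ^ 2 ≤
            (u 0) ^ 2 * ‖y - p - (t * (u 0)⁻¹) • E4.spatial u‖ ^ 2)
    (hCAI : ∀ (φ : E3 → ℝ) (R₀ : ℝ), 0 < R₀ → (∀ y : E3, R₀ < ‖y‖ → ContDiffAt ℝ 1 φ y) →
        (∫⁻ y in {y : E3 | R₀ < ‖y‖}, ENNReal.ofReal (‖fderiv ℝ φ y‖ ^ 2)) ≠ ⊤ →
        ∃ c ρ : ℝ, R₀ ≤ ρ ∧
          ∫⁻ y in {y : E3 | ρ < ‖y‖}, ENNReal.ofReal ((φ y - c) ^ 2 / ‖y‖ ^ 2) < ⊤)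
    (hEB : ∀ N : ℕ, ∃ d₀ α v₀ : ℝ, 0 < d₀ ∧ 0 < α ∧ 0 < v₀ ∧
      ∀ (M a : Fin N → ℝ) (Λ : Fin N → lorentzGroup) (p : Fin N → E3) (u : Fin N → E4)
        (q : Fin N → E4 → E4),
        (∀ i, u i = (Λ i : E4 ≃L[ℝ] E4) (E4.basisVector 0)) →
        (∀ i x, q i x = poincareInv (Λ i) (E4.ofTimeSpace 0 (p i)) x) →
        (∀ i, 0 < M i) → (∀ i, |a i| ≤ α * M i) →
        (∀ i, 0 < u i 0 ∧ ‖E4.spatial (u i)‖ ≤ v₀ * u i 0) →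
        (∀ i j, i ≠ j → d₀ * (M i + M j) ≤ dist (p i) (p j) ∧
          0 < ⟪p i - p j, (u i 0)⁻¹ • E4.spatial (u i) - (u j 0)⁻¹ • E4.spatial (u j)⟫_ℝ) →
        ∀ (G : E4 → Fin 4 → Fin 4 → ℝ),
        (∀ x μ ν, G x μ ν = Minkowski.bilin (E4.basisVector μ) (E4.basisVector ν) -
          ∑ i, Real.smoothTransition (2 - Kerr.radius (a i) (q i x) / (8 * M i)) *
            (2 * Kerr.scalarH (M i) (a i) (q i x)) *
            ((Λ i : E4 ≃L[ℝ] E4) (Kerr.nullVector (a i) (q i x))) μ *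
            ((Λ i : E4 ≃L[ℝ] E4) (Kerr.nullVector (a i) (q i x))) ν) →
        ∀ (E : (E4 → ℝ) → ℝ → ENNReal),
        (∀ φ t, E φ t = ∫⁻ y in {y : E3 | ∀ i, Kerr.rPlus (M i) (a i) <
            Kerr.radius (a i) (q i (E4.ofTimeSpace t y))},
          ENNReal.ofReal (∑ μ : Fin 4, (fderiv ℝ φ (E4.ofTimeSpace t y) (E4.basisVector μ)) ^ 2)) →
        ∃ C : NNReal, ∀ ψ : E4 → ℝ, ContDiff ℝ ∞ ψ →
          (∀ x : E4, 0 ≤ x 0 → (∀ i, Kerr.rPlus (M i) (a i) < Kerr.radius (a i) (q i x)) →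
            ∑ μ : Fin 4, fderiv ℝ (fun y ↦ ∑ ν : Fin 4, G y μ ν * fderiv ℝ ψ y (E4.basisVector ν)) x
              (E4.basisVector μ) = 0) →
          ∀ t : ℝ, 0 ≤ t → E ψ t ≤ (C : ENNReal) * E ψ 0)
    (hNZ : ∀ N : ℕ, ∃ d₀ α v₀ : ℝ, 0 < d₀ ∧ 0 < α ∧ 0 < v₀ ∧
      ∀ (M a : Fin N → ℝ) (Λ : Fin N → lorentzGroup) (p : Fin N → E3) (u : Fin N → E4)
        (q : Fin N → E4 → E4),
        (∀ i, u i = (Λ i : E4 ≃L[ℝ] E4) (E4.basisVector 0)) →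
        (∀ i x, q i x = poincareInv (Λ i) (E4.ofTimeSpace 0 (p i)) x) →
        (∀ i, 0 < M i) → (∀ i, |a i| ≤ α * M i) →
        (∀ i, 0 < u i 0 ∧ ‖E4.spatial (u i)‖ ≤ v₀ * u i 0) →
        (∀ i j, i ≠ j → d₀ * (M i + M j) ≤ dist (p i) (p j) ∧
          0 < ⟪p i - p j, (u i 0)⁻¹ • E4.spatial (u i) - (u j 0)⁻¹ • E4.spatial (u j)⟫_ℝ) →
        ∀ (G : E4 → Fin 4 → Fin 4 → ℝ),
        (∀ x μ ν, G x μ ν = Minkowski.bilin (E4.basisVector μ) (E4.basisVector ν) -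
          ∑ i, Real.smoothTransition (2 - Kerr.radius (a i) (q i x) / (8 * M i)) *
            (2 * Kerr.scalarH (M i) (a i) (q i x)) *
            ((Λ i : E4 ≃L[ℝ] E4) (Kerr.nullVector (a i) (q i x))) μ *
            ((Λ i : E4 ≃L[ℝ] E4) (Kerr.nullVector (a i) (q i x))) ν) →
        ∀ (E : (E4 → ℝ) → ℝ → ENNReal),
        (∀ φ t, E φ t = ∫⁻ y in {y : E3 | ∀ i, Kerr.rPlus (M i) (a i) <
            Kerr.radius (a i) (q i (E4.ofTimeSpace t y))},
          ENNReal.ofReal (∑ μ : Fin 4, (fderiv ℝ φ (E4.ofTimeSpace t y) (E4.basisVector μ)) ^ 2)) →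
        ∃ C : NNReal, ∀ ψ : E4 → ℝ, ContDiff ℝ ∞ ψ →
          (∀ x : E4, 0 ≤ x 0 → (∀ i, Kerr.rPlus (M i) (a i) < Kerr.radius (a i) (q i x)) →
            ∑ μ : Fin 4, fderiv ℝ (fun y ↦ ∑ ν : Fin 4, G y μ ν * fderiv ℝ ψ y (E4.basisVector ν)) x
              (E4.basisVector μ) = 0) →
          ∀ c : ℝ, (∃ ρ : ℝ, ∫⁻ y in {y : E3 | ρ < ‖y‖},
              ENNReal.ofReal ((ψ (E4.ofTimeSpace 0 y) - c) ^ 2 / ‖y‖ ^ 2) < ⊤) →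
          ∀ i, ∫⁻ t in Set.Ioi (0 : ℝ), ∫⁻ y in {y : E3 | Kerr.radius (a i) (q i (E4.ofTimeSpace t y)) < 64 * M i ∧
              ∀ j, Kerr.rPlus (M j) (a j) < Kerr.radius (a j) (q j (E4.ofTimeSpace t y))},
              (ENNReal.ofReal (∑ μ : Fin 4, (fderiv ℝ ψ (E4.ofTimeSpace t y) (E4.basisVector μ)) ^ 2) +
                ENNReal.ofReal ((ψ (E4.ofTimeSpace t y) - c) ^ 2 / (M i) ^ 2)) ≤
            (C : ENNReal) * (E ψ 0 + E (fun x ↦ fderiv ℝ ψ x (E4.basisVector 0)) 0))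
    (hFMB : ∀ R : ℝ, 0 < R → ∃ (g ϖ : ℝ → ℝ) (c₀ : ℝ), 0 < c₀ ∧
        ContDiff ℝ ∞ (fun y : E4 ↦ g (E4.spatialNorm y ^ 2)) ∧
        ContDiff ℝ ∞ (fun y : E4 ↦ ϖ (E4.spatialNorm y ^ 2)) ∧
        (∀ y : E4, |g (E4.spatialNorm y ^ 2)| * E4.spatialNorm y ≤ 1) ∧
        (∀ y : E4, |ϖ (E4.spatialNorm y ^ 2)| * (E4.spatialNorm y + R) ≤ 8) ∧
        (∀ y : E4, ‖fderiv ℝ (fun z : E4 ↦ ϖ (E4.spatialNorm z ^ 2)) y‖ *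
          (E4.spatialNorm y + R) ^ 2 ≤ 32) ∧
        (∀ (w : E4 → ℝ) (x : E4),
          0 ≤ KerrSchild.multiplierBulk (fun _ ↦ Kerr.etaComp)
              (fun y α ↦ if α = 0 then (0 : ℝ) else g (E4.spatialNorm y ^ 2) * y α) w x +
            4⁻¹ * (ϖ (E4.spatialNorm x ^ 2) * ∑ α, ∑ β, Kerr.etaComp α β *
              fderiv ℝ w x (E4.basisVector α) * fderiv ℝ w x (E4.basisVector β)) -
            8⁻¹ * KerrSchild.waveOperator (fun _ ↦ Kerr.etaComp)
              (fun y ↦ ϖ (E4.spatialNorm y ^ 2)) x * w x ^ 2) ∧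
        (∀ (w : E4 → ℝ) (x : E4), E4.spatialNorm x ≤ R →
          c₀ * ∑ μ : Fin 4, (fderiv ℝ w x (E4.basisVector μ)) ^ 2 ≤
            KerrSchild.multiplierBulk (fun _ ↦ Kerr.etaComp)
              (fun y α ↦ if α = 0 then (0 : ℝ) else g (E4.spatialNorm y ^ 2) * y α) w x +
            4⁻¹ * (ϖ (E4.spatialNorm x ^ 2) * ∑ α, ∑ β, Kerr.etaComp α β *
              fderiv ℝ w x (E4.basisVector α) * fderiv ℝ w x (E4.basisVector β)) -
            8⁻¹ * KerrSchild.waveOperator (fun _ ↦ Kerr.etaComp)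
              (fun y ↦ ϖ (E4.spatialNorm y ^ 2)) x * w x ^ 2))
    (hPH : ∃ K : NNReal, ∀ (n : ℕ) (c : Fin n → E3) (ρ : Fin n → ℝ), (∀ i, 0 < ρ i) →
        (∀ i j, i ≠ j → 4 * (ρ i + ρ j) ≤ dist (c i) (c j)) →
        ∀ φ : E3 → ℝ, (∀ y : E3, (∀ i, ρ i < dist y (c i)) → ContDiffAt ℝ 1 φ y) →
        (∃ ρ₀ : ℝ, ∫⁻ y in {y : E3 | ρ₀ < ‖y‖}, ENNReal.ofReal (φ y ^ 2 / ‖y‖ ^ 2) < ⊤) →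
        ∀ y₀ : E3, ∫⁻ y in {y : E3 | ∀ i, 2 * ρ i < dist y (c i)},
            ENNReal.ofReal (φ y ^ 2 / ‖y - y₀‖ ^ 2) ≤
          (K : ENNReal) * ∫⁻ y in {y : E3 | ∀ i, ρ i < dist y (c i)}, ENNReal.ofReal (‖fderiv ℝ φ y‖ ^ 2))
    (hFAR : (∀ (Λ : lorentzGroup) (p : E3) (u : E4) (q : E4 → E4),
        u = (Λ : E4 ≃L[ℝ] E4) (E4.basisVector 0) →
        (∀ x, q x = poincareInv Λ (E4.ofTimeSpace 0 p) x) → 0 < u 0 →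
        ∀ (t : ℝ) (y : E3),
          ‖y - p - (t * (u 0)⁻¹) • E4.spatial u‖ ^ 2 ≤ E4.spatialNorm (q (E4.ofTimeSpace t y)) ^ 2 ∧
          E4.spatialNorm (q (E4.ofTimeSpace t y)) ^ 2 ≤
            (u 0) ^ 2 * ‖y - p - (t * (u 0)⁻¹) • E4.spatial u‖ ^ 2) →
      (∀ R : ℝ, 0 < R → ∃ (g ϖ : ℝ → ℝ) (c₀ : ℝ), 0 < c₀ ∧
        ContDiff ℝ ∞ (fun y : E4 ↦ g (E4.spatialNorm y ^ 2)) ∧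
        ContDiff ℝ ∞ (fun y : E4 ↦ ϖ (E4.spatialNorm y ^ 2)) ∧
        (∀ y : E4, |g (E4.spatialNorm y ^ 2)| * E4.spatialNorm y ≤ 1) ∧
        (∀ y : E4, |ϖ (E4.spatialNorm y ^ 2)| * (E4.spatialNorm y + R) ≤ 8) ∧
        (∀ y : E4, ‖fderiv ℝ (fun z : E4 ↦ ϖ (E4.spatialNorm z ^ 2)) y‖ *
          (E4.spatialNorm y + R) ^ 2 ≤ 32) ∧
        (∀ (w : E4 → ℝ) (x : E4),
          0 ≤ KerrSchild.multiplierBulk (fun _ ↦ Kerr.etaComp)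
              (fun y α ↦ if α = 0 then (0 : ℝ) else g (E4.spatialNorm y ^ 2) * y α) w x +
            4⁻¹ * (ϖ (E4.spatialNorm x ^ 2) * ∑ α, ∑ β, Kerr.etaComp α β *
              fderiv ℝ w x (E4.basisVector α) * fderiv ℝ w x (E4.basisVector β)) -
            8⁻¹ * KerrSchild.waveOperator (fun _ ↦ Kerr.etaComp)
              (fun y ↦ ϖ (E4.spatialNorm y ^ 2)) x * w x ^ 2) ∧
        (∀ (w : E4 → ℝ) (x : E4), E4.spatialNorm x ≤ R →
          c₀ * ∑ μ : Fin 4, (fderiv ℝ w x (E4.basisVector μ)) ^ 2 ≤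
            KerrSchild.multiplierBulk (fun _ ↦ Kerr.etaComp)
              (fun y α ↦ if α = 0 then (0 : ℝ) else g (E4.spatialNorm y ^ 2) * y α) w x +
            4⁻¹ * (ϖ (E4.spatialNorm x ^ 2) * ∑ α, ∑ β, Kerr.etaComp α β *
              fderiv ℝ w x (E4.basisVector α) * fderiv ℝ w x (E4.basisVector β)) -
            8⁻¹ * KerrSchild.waveOperator (fun _ ↦ Kerr.etaComp)
              (fun y ↦ ϖ (E4.spatialNorm y ^ 2)) x * w x ^ 2)) →
      (∃ K : NNReal, ∀ (n : ℕ) (c : Fin n → E3) (ρ : Fin n → ℝ), (∀ i, 0 < ρ i) →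
        (∀ i j, i ≠ j → 4 * (ρ i + ρ j) ≤ dist (c i) (c j)) →
        ∀ φ : E3 → ℝ, (∀ y : E3, (∀ i, ρ i < dist y (c i)) → ContDiffAt ℝ 1 φ y) →
        (∃ ρ₀ : ℝ, ∫⁻ y in {y : E3 | ρ₀ < ‖y‖}, ENNReal.ofReal (φ y ^ 2 / ‖y‖ ^ 2) < ⊤) →
        ∀ y₀ : E3, ∫⁻ y in {y : E3 | ∀ i, 2 * ρ i < dist y (c i)},
            ENNReal.ofReal (φ y ^ 2 / ‖y - y₀‖ ^ 2) ≤
          (K : ENNReal) * ∫⁻ y in {y : E3 | ∀ i, ρ i < dist y (c i)}, ENNReal.ofReal (‖fderiv ℝ φ y‖ ^ 2)) →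
      ∀ N : ℕ, ∃ d₀ α v₀ : ℝ, 0 < d₀ ∧ 0 < α ∧ 0 < v₀ ∧
      ∀ (M a : Fin N → ℝ) (Λ : Fin N → lorentzGroup) (p : Fin N → E3) (u : Fin N → E4)
        (q : Fin N → E4 → E4),
        (∀ i, u i = (Λ i : E4 ≃L[ℝ] E4) (E4.basisVector 0)) →
        (∀ i x, q i x = poincareInv (Λ i) (E4.ofTimeSpace 0 (p i)) x) →
        (∀ i, 0 < M i) → (∀ i, |a i| ≤ α * M i) →
        (∀ i, 0 < u i 0 ∧ ‖E4.spatial (u i)‖ ≤ v₀ * u i 0) →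
        (∀ i j, i ≠ j → d₀ * (M i + M j) ≤ dist (p i) (p j) ∧
          0 < ⟪p i - p j, (u i 0)⁻¹ • E4.spatial (u i) - (u j 0)⁻¹ • E4.spatial (u j)⟫_ℝ) →
        ∀ (G : E4 → Fin 4 → Fin 4 → ℝ),
        (∀ x μ ν, G x μ ν = Minkowski.bilin (E4.basisVector μ) (E4.basisVector ν) -
          ∑ i, Real.smoothTransition (2 - Kerr.radius (a i) (q i x) / (8 * M i)) *
            (2 * Kerr.scalarH (M i) (a i) (q i x)) *
            ((Λ i : E4 ≃L[ℝ] E4) (Kerr.nullVector (a i) (q i x))) μ *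
            ((Λ i : E4 ≃L[ℝ] E4) (Kerr.nullVector (a i) (q i x))) ν) →
        ∀ (E : (E4 → ℝ) → ℝ → ENNReal),
        (∀ φ t, E φ t = ∫⁻ y in {y : E3 | ∀ i, Kerr.rPlus (M i) (a i) <
            Kerr.radius (a i) (q i (E4.ofTimeSpace t y))},
          ENNReal.ofReal (∑ μ : Fin 4, (fderiv ℝ φ (E4.ofTimeSpace t y) (E4.basisVector μ)) ^ 2)) →
        ∀ R : ℝ, ∃ C : NNReal, ∀ ψ : E4 → ℝ, ContDiff ℝ ∞ ψ →
          (∀ x : E4, 0 ≤ x 0 → (∀ i, Kerr.rPlus (M i) (a i) < Kerr.radius (a i) (q i x)) →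
            ∑ μ : Fin 4, fderiv ℝ (fun y ↦ ∑ ν : Fin 4, G y μ ν * fderiv ℝ ψ y (E4.basisVector ν)) x
              (E4.basisVector μ) = 0) →
          ∀ c : ℝ, (∃ ρ : ℝ, ∫⁻ y in {y : E3 | ρ < ‖y‖},
              ENNReal.ofReal ((ψ (E4.ofTimeSpace 0 y) - c) ^ 2 / ‖y‖ ^ 2) < ⊤) →
          ∫⁻ t in Set.Ioi (0 : ℝ), ∫⁻ y in {y : E3 | ‖y‖ ≤ R ∧ ∀ i, Kerr.rPlus (M i) (a i) <
              Kerr.radius (a i) (q i (E4.ofTimeSpace t y))},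
              ENNReal.ofReal (∑ μ : Fin 4, (fderiv ℝ ψ (E4.ofTimeSpace t y) (E4.basisVector μ)) ^ 2) ≤
            (C : ENNReal) * ((⨆ t : ℝ, ⨆ (_ : 0 ≤ t), E ψ t) +
              ∑ i, ∫⁻ t in Set.Ioi (0 : ℝ), ∫⁻ y in {y : E3 | Kerr.radius (a i) (q i (E4.ofTimeSpace t y)) < 64 * M i ∧
                ∀ j, Kerr.rPlus (M j) (a j) < Kerr.radius (a j) (q j (E4.ofTimeSpace t y))},
                (ENNReal.ofReal (∑ μ : Fin 4, (fderiv ℝ ψ (E4.ofTimeSpace t y) (E4.basisVector μ)) ^ 2) +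
                  ENNReal.ofReal ((ψ (E4.ofTimeSpace t y) - c) ^ 2 / (M i) ^ 2)))) :
    id Summit.FinalStateConjecture.FinalStateConjecture.Theses.ClusterCompleteness.AdiabaticMultiKerrILED := by
  show Summit.FinalStateConjecture.FinalStateConjecture.Theses.ClusterCompleteness.AdiabaticMultiKerrILED
  intro N
  obtain ⟨d₁, α₁, v₁, hd₁, hα₁, hv₁, H1⟩ := hEB N
  obtain ⟨d₂, α₂, v₂, hd₂, hα₂, hv₂, H2⟩ := hNZ N
  obtain ⟨d₃, α₃, v₃, hd₃, hα₃, hv₃, H3⟩ := hFAR hZG hFMB hPH N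
  refine ⟨max d₁ (max d₂ d₃), min 1 (min α₁ (min α₂ α₃)), min v₁ (min v₂ v₃),
    lt_max_of_lt_left hd₁, lt_min one_pos (lt_min hα₁ (lt_min hα₂ hα₃)),
    lt_min hv₁ (lt_min hv₂ hv₃), ?_⟩
  intro M a Λ p u q hu hq hM ha hv hsep G hG E hE R
  -- the hypotheses of the three quantitative stubs
  have hmono_a : ∀ {β : ℝ}, min 1 (min α₁ (min α₂ α₃)) ≤ β → ∀ i, |a i| ≤ β * M i :=
    fun hβ i ↦ (ha i).trans (mul_le_mul_of_nonneg_right hβ (hM i).le)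
  have hmono_v : ∀ {w : ℝ}, min v₁ (min v₂ v₃) ≤ w →
      ∀ i, 0 < u i 0 ∧ ‖E4.spatial (u i)‖ ≤ w * u i 0 :=
    fun hw i ↦ ⟨(hv i).1, (hv i).2.trans (mul_le_mul_of_nonneg_right hw (hv i).1.le)⟩
  have hmono_d : ∀ {d : ℝ}, d ≤ max d₁ (max d₂ d₃) → ∀ i j, i ≠ j →
      d * (M i + M j) ≤ dist (p i) (p j) ∧
        0 < ⟪p i - p j, (u i 0)⁻¹ • E4.spatial (u i) - (u j 0)⁻¹ • E4.spatial (u j)⟫_ℝ :=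
    fun hd i j hij ↦ ⟨(mul_le_mul_of_nonneg_right hd (add_pos (hM i) (hM j)).le).trans
      (hsep i j hij).1, (hsep i j hij).2⟩
  have hα₁le : min 1 (min α₁ (min α₂ α₃)) ≤ α₁ := (min_le_right _ _).trans (min_le_left _ _)
  have hα₂le : min 1 (min α₁ (min α₂ α₃)) ≤ α₂ :=
    (min_le_right _ _).trans ((min_le_right _ _).trans (min_le_left _ _))
  have hα₃le : min 1 (min α₁ (min α₂ α₃)) ≤ α₃ :=
    (min_le_right _ _).trans ((min_le_right _ _).trans (min_le_right _ _))
  have hαone : min 1 (min α₁ (min α₂ α₃)) ≤ 1 := min_le_left _ _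
  obtain ⟨Ca, HCa⟩ := H1 M a Λ p u q hu hq hM (hmono_a hα₁le) (hmono_v (min_le_left _ _))
    (hmono_d (le_max_left _ _)) G hG E hE
  have hd₂le : d₂ ≤ max d₁ (max d₂ d₃) := (le_max_left d₂ d₃).trans (le_max_right d₁ _)
  have hd₃le : d₃ ≤ max d₁ (max d₂ d₃) := (le_max_right d₂ d₃).trans (le_max_right d₁ _)
  obtain ⟨Cn, HCn⟩ := H2 M a Λ p u q hu hq hM (hmono_a hα₂le)
    (hmono_v ((min_le_right _ _).trans (min_le_left _ _))) (hmono_d hd₂le) G hG E hE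
  obtain ⟨Cf, HCf⟩ := H3 M a Λ p u q hu hq hM (hmono_a hα₃le)
    (hmono_v ((min_le_right _ _).trans (min_le_right _ _))) (hmono_d hd₃le) G hG E hE R
  -- the constant
  set C : NNReal := max 1 (max Ca (Cf * (Ca + N * Cn))) with hCdef
  have hC1 : (1 : ℝ≥0∞) ≤ C := by
    rw [hCdef]; exact_mod_cast le_max_left _ _
  have hCa : (Ca : ℝ≥0∞) ≤ C := by
    rw [hCdef]; exact_mod_cast (le_max_left _ _).trans (le_max_right _ _)
  have hCf : (Cf : ℝ≥0∞) * (Ca + N * Cn) ≤ C := by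
    have h : Cf * (Ca + N * Cn) ≤ C := (le_max_right _ _).trans (le_max_right _ _)
    have h' : ((Cf * (Ca + N * Cn) : NNReal) : ℝ≥0∞) ≤ (C : ℝ≥0∞) := by exact_mod_cast h
    simpa using h'
  refine ⟨C, fun ψ hψ hsol ↦ ⟨fun t ht ↦ (HCa ψ hψ hsol t ht).trans (by gcongr), ?_⟩⟩
  -- (b)
  set E0 := E ψ 0 with hE0
  set E1 := E (fun x ↦ fderiv ℝ ψ x (E4.basisVector 0)) 0 with hE1
  by_cases htop : E0 = ⊤
  · -- infinite initial energy: the right-hand side is `⊤`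
    have : (C : ℝ≥0∞) * (E0 + E1) = ⊤ := by
      rw [htop, top_add, ENNReal.mul_top]
      exact (lt_of_lt_of_le one_pos hC1).ne'
    rw [this]; exact le_top
  -- finite initial energy: normalise `ψ(0, ·)` by its constant at infinity
  have hsup : (⨆ t : ℝ, ⨆ (_ : 0 ≤ t), E ψ t) ≤ Ca * E0 := iSup₂_le fun t ht ↦ HCa ψ hψ hsol t ht
  obtain ⟨c, hnorm⟩ : ∃ c : ℝ, ∃ ρ : ℝ, ∫⁻ y in {y : E3 | ρ < ‖y‖},
      ENNReal.ofReal ((ψ (E4.ofTimeSpace 0 y) - c) ^ 2 / ‖y‖ ^ 2) < ⊤ := by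
    -- a ball containing every hole at `t = 0`
    set R₀ : ℝ := 1 + ∑ i, (‖p i‖ + 3 * M i) with hR₀
    have hterm : ∀ i, 0 ≤ ‖p i‖ + 3 * M i := fun i ↦ by
      have := (hM i).le; positivity
    have hR₀pos : 0 < R₀ := by
      have := Finset.sum_nonneg fun i (_ : i ∈ Finset.univ) ↦ hterm i
      linarith
    have hR₀i : ∀ i, ‖p i‖ + 3 * M i ≤ R₀ := fun i ↦ by
      have := Finset.single_le_sum (f := fun j ↦ ‖p j‖ + 3 * M j) (fun j _ ↦ hterm j)
        (Finset.mem_univ i)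
      linarith
    -- the slice function and its regularity
    set φ : E3 → ℝ := fun y ↦ ψ (E4.ofTimeSpace 0 y) with hφ
    have hφC : ContDiff ℝ ∞ φ := hψ.comp (E4.contDiff_ofTimeSpace 0)
    have hφ1 : ∀ y : E3, R₀ < ‖y‖ → ContDiffAt ℝ 1 φ y := fun y _ ↦
      (hφC.of_le (by exact_mod_cast le_top)).contDiffAt
    -- far out at `t = 0` every point is exterior, and the slice gradient is below the energy density
    have hext : ∀ y : E3, R₀ < ‖y‖ →
        ∀ i, Kerr.rPlus (M i) (a i) < Kerr.radius (a i) (q i (E4.ofTimeSpace 0 y)) :=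
      fun y hy i ↦ rPlus_lt_radius_of_far hZG (hu i) (hq i) (hv i).1 (hM i)
        ((ha i).trans ((mul_le_mul_of_nonneg_right hαone (hM i).le).trans (one_mul _).le))
        (hR₀i i) hy
    have hpt : ∀ y : E3, ENNReal.ofReal (‖fderiv ℝ φ y‖ ^ 2) ≤
        ENNReal.ofReal (∑ μ : Fin 4,
          (fderiv ℝ ψ (E4.ofTimeSpace 0 y) (E4.basisVector μ)) ^ 2) := fun y ↦ by
      refine ENNReal.ofReal_le_ofReal ?_
      rw [hφ, fderiv_slice_eq ((hψ.differentiable (by simp)).differentiableAt)]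
      exact norm_comp_spaceEmbed_sq_le _
    have hfin : (∫⁻ y in {y : E3 | R₀ < ‖y‖}, ENNReal.ofReal (‖fderiv ℝ φ y‖ ^ 2)) ≠ ⊤ := by
      refine (lt_of_le_of_lt ?_ (lt_top_iff_ne_top.mpr htop)).ne
      rw [hE0, hE]
      exact (lintegral_mono fun y ↦ hpt y).trans (lintegral_mono_set fun y hy ↦ hext y hy)
    obtain ⟨c, ρ, -, hcρ⟩ := hCAI φ R₀ hR₀pos hφ1 hfin
    exact ⟨c, ρ, hcρ⟩
  have hZ := HCn ψ hψ hsol c hnorm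
  have hL := HCf ψ hψ hsol c hnorm
  refine hL.trans ?_
  calc (Cf : ℝ≥0∞) * ((⨆ t : ℝ, ⨆ (_ : 0 ≤ t), E ψ t) + ∑ i, _)
      ≤ Cf * (Ca * E0 + ∑ _i : Fin N, (Cn : ℝ≥0∞) * (E0 + E1)) := by
        gcongr with i
        exact hZ i
    _ = Cf * (Ca * E0 + N * (Cn * (E0 + E1))) := by
        rw [Finset.sum_const, Finset.card_univ, Fintype.card_fin, nsmul_eq_mul]
    _ ≤ Cf * (Ca * (E0 + E1) + N * (Cn * (E0 + E1))) := by
        gcongr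
        exact le_self_add
    _ = Cf * (Ca + N * Cn) * (E0 + E1) := by ring
    _ ≤ C * (E0 + E1) := by gcongr

/-- **Composition (skeleton theorem, v9).** The crux `AdiabaticMultiKerrILED`, BY NAME and without
hypotheses: five classical stubs imported from their landed `…Theorems…` modules; (a) = `energyBound` from the
classical finite-time growth bound (`stub_finiteTimeEnergy_of` ∘ `stub_zoneDisjoint`, `stub_pointwiseTerm`,
`stub_termDerivBound`, `stub_horizonFactor`) and the late-time research stub `stub_lateEnergyBound`;
`stub_nearZoneILED` is the second research stub. -/
theorem AdiabaticMultiKerrILED_of :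
    Summit.FinalStateConjecture.FinalStateConjecture.Theses.ClusterCompleteness.AdiabaticMultiKerrILED :=
  adiabaticMultiKerrILED_of_statements stub_zoneKinematics stub_constantAtInfinity energyBound
    nearZoneILED stub_flatMorawetzBulk stub_perforatedHardy stub_farTransport

end Summit.FinalStateConjecture.FinalStateConjecture.Cruxes.AdiabaticMultiKerrILED.Sketch

end
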